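import Mathlib
import Summits.KontsevichZagierPeriods.KontsevichZagierPeriods.Theorems.ZagierDilogarithmConjecture.Negative.DehnInvariant
import Summits.KontsevichZagierPeriods.KontsevichZagierPeriods.Theorems.ZagierDilogarithmConjecture.Negative.DehnWitness
import HarnessLib

/-!
# `ZagierDilogarithmConjecture` (stmt-KontsevichZagierPeriods-10550) — line `kummer-clausen-linearisation`
# (c5 cycle 4, "the Gaussian exceptional-unit sector"), stub `stub_gsecDehnRows`

**The Dehn-type invariant of the 15 class representatives of the Gaussian exceptional-unit sector, read by
valuation characters.** Let `ρ = 1 + i`, `π = 2 + i`, `π̄ = 2 − i` and let `u, v, w : ℂˣ → ℚ` be additive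
characters with `u(ρ) = 1, u(π) = u(π̄) = 0`, `v(π) = 1, v(ρ) = v(π̄) = 0`, `w(π̄) = 1, w(ρ) = w(π) = 0`
(`ext` = the character read on `ℂ`, `0 ↦ 0`). For the representatives
`r₀,…,r₁₄ = −7+24i, (−7−24i)/25, (−6+2i)/5, −2+4i, −i/2, (1−2i)/2, −2−i, −i, (1−3i)/2, −1−i, −1−2i, (1−7i)/2,
−3+4i, (−3−4i)/5, (2−11i)/4` the values `dehn u v [r_j]` and `dehn v w [r_j]` of the Dehn-type invariant of
`Negative/DehnInvariant.lean` are the 30 explicit integers of `stub_gsecDehnRows` (they are `F₁(r_j)` and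
`2F₂(r_j)` for the two asymmetrised wedge functionals `F₁ = λ_{ρπ} − λ_{ρπ̄}`, `F₂ = λ_{ππ̄}` of the lead's
linear algebra).

Proof. Every `r_j` and every `1 − r_j` is an `{i, ρ, π, π̄}`-monomial: `r · M₁ = M₂`, `(1 − r) · M₃ = M₄` with
monomials `M = i^a ρ^b π^c π̄^d` of natural exponents (the 30 identities are checked by `norm_num` on real and
imaginary parts). `ext χ` is additive on non-zero products and kills the fourth root of unity `i`, so
`ext χ (i^a ρ^b π^c π̄^d) = b χ(ρ) + c χ(π) + d χ(π̄)` (`ext_gsecMonomial`), and since `conj i = −i`,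
`conj ρ = −i ρ`, `conj π = π̄`: `ext χ (conj (i^a ρ^b π^c π̄^d)) = b χ(ρ) + d χ(π) + c χ(π̄)`
(`ext_conj_gsecMonomial`). Unfolding `dehn_of`, `asym`, `sym` then gives closed bilinear expressions in the
exponents (`dehn_row`), evaluated row by row. Sorry-free; axioms ⊆ {propext, Classical.choice, Quot.sound}.
-/

noncomputable section

open Complex
open scoped ComplexConjugate
open Summit.KontsevichZagierPeriods.HyperbolicBloch
open Summit.KontsevichZagierPeriods.HyperbolicBloch.ZagierDilogarithmConjectureNegative (dehn)

namespace Summit.KontsevichZagierPeriods.HyperbolicBloch.ZagierDilogarithmCertificate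

section monomials

open ZagierDilogarithmConjectureNegative

/-- The `{i, 1+i, 2+i, 2−i}`-monomials `i^a (1+i)^b (2+i)^c (2−i)^d` are non-zero. [folklore] -/
theorem gsecMonomial_ne_zero (a b c d : ℕ) :
    I ^ a * (1 + I) ^ b * (2 + I) ^ c * (2 - I) ^ d ≠ 0 := by
  have hρ : (1 + I : ℂ) ≠ 0 := fun e => by simpa using congrArg Complex.re e
  exact mul_ne_zero (mul_ne_zero (mul_ne_zero (pow_ne_zero _ I_ne_zero) (pow_ne_zero _ hρ))
    (pow_ne_zero _ two_add_I_ne_zero)) (pow_ne_zero _ two_sub_I_ne_zero)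

/-- `ext u` on natural powers of a non-zero number: `ext u (p ^ n) = n · ext u p`. [folklore] -/
theorem ext_pow_nat (u : Additive ℂˣ →+ ℚ) {p : ℂ} (hp : p ≠ 0) (n : ℕ) :
    ext u (p ^ n) = n * ext u p := by
  induction n with
  | zero => simp [ext_one]
  | succ m ih => rw [pow_succ, ext_mul u (pow_ne_zero m hp) hp, ih]; push_cast; ring

/-- `ext u` of a product of four natural powers of non-zero numbers. [folklore] -/
theorem ext_mul_four_pow (u : Additive ℂˣ →+ ℚ) {p q r s : ℂ} (hp : p ≠ 0) (hq : q ≠ 0) (hr : r ≠ 0)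
    (hs : s ≠ 0) (a b c d : ℕ) :
    ext u (p ^ a * q ^ b * r ^ c * s ^ d) = a * ext u p + b * ext u q + c * ext u r + d * ext u s := by
  rw [ext_mul u (mul_ne_zero (mul_ne_zero (pow_ne_zero _ hp) (pow_ne_zero _ hq)) (pow_ne_zero _ hr))
      (pow_ne_zero _ hs), ext_mul u (mul_ne_zero (pow_ne_zero _ hp) (pow_ne_zero _ hq)) (pow_ne_zero _ hr),
    ext_mul u (pow_ne_zero _ hp) (pow_ne_zero _ hq), ext_pow_nat u hp, ext_pow_nat u hq, ext_pow_nat u hr,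
    ext_pow_nat u hs]

/-- `ext u` kills `i` (a fourth root of unity). [folklore] -/
theorem ext_I (u : Additive ℂˣ →+ ℚ) : ext u I = 0 :=
  ext_eq_zero_of_pow_eq_one u (n := 4) (by norm_num) I_pow_four

/-- `ext u` kills `−i`. [folklore] -/
theorem ext_neg_I (u : Additive ℂˣ →+ ℚ) : ext u (-I) = 0 := by
  rw [ext_neg u I_ne_zero, ext_I]

/-- `ext u (1 − i) = ext u (1 + i)` since `1 − i = −i (1 + i)`. [folklore] -/
theorem ext_one_sub_I (u : Additive ℂˣ →+ ℚ) : ext u (1 - I) = ext u (1 + I) := by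
  have hρ : (1 + I : ℂ) ≠ 0 := fun e => by simpa using congrArg Complex.re e
  have h : (1 - I : ℂ) = -I * (1 + I) := by linear_combination I_sq
  rw [h, ext_mul u (neg_ne_zero.mpr I_ne_zero) hρ, ext_neg_I, zero_add]

/-- `ext u` of a monomial: `ext u (i^a ρ^b π^c π̄^d) = b u(ρ) + c u(π) + d u(π̄)`. [folklore] -/
theorem ext_gsecMonomial (u : Additive ℂˣ →+ ℚ) (a b c d : ℕ) :
    ext u (I ^ a * (1 + I) ^ b * (2 + I) ^ c * (2 - I) ^ d) =
      b * ext u (1 + I) + c * ext u (2 + I) + d * ext u (2 - I) := by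
  have hρ : (1 + I : ℂ) ≠ 0 := fun e => by simpa using congrArg Complex.re e
  rw [ext_mul_four_pow u I_ne_zero hρ two_add_I_ne_zero two_sub_I_ne_zero, ext_I, mul_zero, zero_add]

/-- Complex conjugate of a monomial: `conj (i^a ρ^b π^c π̄^d) = (−i)^a (1−i)^b π̄^c π^d`. [folklore] -/
theorem conj_gsecMonomial (a b c d : ℕ) :
    conj (I ^ a * (1 + I) ^ b * (2 + I) ^ c * (2 - I) ^ d) =
      (-I) ^ a * (1 - I) ^ b * (2 - I) ^ c * (2 + I) ^ d := by
  simp only [map_mul, map_pow, conj_I, map_add, map_sub, map_one, map_ofNat]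
  ring

/-- `ext u` of a conjugated monomial: `ext u (conj (i^a ρ^b π^c π̄^d)) = b u(ρ) + d u(π) + c u(π̄)`
(conjugation swaps `π ↔ π̄` and multiplies `ρ` by the root of unity `−i`). [folklore] -/
theorem ext_conj_gsecMonomial (u : Additive ℂˣ →+ ℚ) (a b c d : ℕ) :
    ext u (conj (I ^ a * (1 + I) ^ b * (2 + I) ^ c * (2 - I) ^ d)) =
      b * ext u (1 + I) + d * ext u (2 + I) + c * ext u (2 - I) := by
  have hρ' : (1 - I : ℂ) ≠ 0 := fun e => by simpa using congrArg Complex.re e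
  rw [conj_gsecMonomial, ext_mul_four_pow u (neg_ne_zero.mpr I_ne_zero) hρ' two_sub_I_ne_zero
    two_add_I_ne_zero, ext_neg_I, ext_one_sub_I, mul_zero, zero_add, add_right_comm]

/-- Reading `ext u z` and `ext u (conj z)` off a factorisation `z · M₁ = M₂` into monomials. [folklore] -/
theorem ext_of_mul_gsecMonomial (u : Additive ℂˣ →+ ℚ) {z : ℂ} {a₁ b₁ c₁ d₁ a₂ b₂ c₂ d₂ : ℕ}
    (h : z * (I ^ a₁ * (1 + I) ^ b₁ * (2 + I) ^ c₁ * (2 - I) ^ d₁) =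
      I ^ a₂ * (1 + I) ^ b₂ * (2 + I) ^ c₂ * (2 - I) ^ d₂) :
    ext u z = ((b₂ : ℚ) - b₁) * ext u (1 + I) + ((c₂ : ℚ) - c₁) * ext u (2 + I) +
        ((d₂ : ℚ) - d₁) * ext u (2 - I) ∧
      ext u (conj z) = ((b₂ : ℚ) - b₁) * ext u (1 + I) + ((d₂ : ℚ) - d₁) * ext u (2 + I) +
        ((c₂ : ℚ) - c₁) * ext u (2 - I) := by
  have hz : z ≠ 0 := by
    rintro rfl
    exact gsecMonomial_ne_zero a₂ b₂ c₂ d₂ (by rw [← h, zero_mul])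
  have e₁ := congrArg (ext u) h
  rw [ext_mul u hz (gsecMonomial_ne_zero _ _ _ _), ext_gsecMonomial, ext_gsecMonomial] at e₁
  have h' := congrArg conj h
  rw [map_mul] at h'
  have e₂ := congrArg (ext u) h'
  rw [ext_mul u ((map_ne_zero _).mpr hz) ((map_ne_zero _).mpr (gsecMonomial_ne_zero _ _ _ _)),
    ext_conj_gsecMonomial, ext_conj_gsecMonomial] at e₂
  constructor
  · linear_combination e₁
  · linear_combination e₂

/-- **One row of the table.** For valuation characters `u, v, w` at `ρ = 1+i`, `π = 2+i`, `π̄ = 2−i` and a point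
`z` with monomial factorisations `z · M₁ = M₂`, `(1 − z) · M₃ = M₄` (checked numerically, `norm_num` on real and
imaginary parts), `dehn u v [z]` and `dehn v w [z]` are the displayed bilinear expressions in the exponents
(`u` reads the `ρ`-exponent, `v` the `π`-exponent, `w` the `π̄`-exponent; conjugation swaps `π ↔ π̄`). [folklore] -/
theorem dehn_row (u v w : Additive ℂˣ →+ ℚ)
    (hu₁ : ext u (1 + I) = 1) (hu₂ : ext u (2 + I) = 0) (hu₃ : ext u (2 - I) = 0)
    (hv₁ : ext v (1 + I) = 0) (hv₂ : ext v (2 + I) = 1) (hv₃ : ext v (2 - I) = 0)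
    (hw₁ : ext w (1 + I) = 0) (hw₂ : ext w (2 + I) = 0) (hw₃ : ext w (2 - I) = 1)
    (z : ℂ) (a₁ b₁ c₁ d₁ a₂ b₂ c₂ d₂ a₃ b₃ c₃ d₃ a₄ b₄ c₄ d₄ : ℕ) (m n : ℚ)
    (hz : z * (I ^ a₁ * (1 + I) ^ b₁ * (2 + I) ^ c₁ * (2 - I) ^ d₁) =
      I ^ a₂ * (1 + I) ^ b₂ * (2 + I) ^ c₂ * (2 - I) ^ d₂ := by norm_num [Complex.ext_iff, pow_succ])
    (hz' : (1 - z) * (I ^ a₃ * (1 + I) ^ b₃ * (2 + I) ^ c₃ * (2 - I) ^ d₃) =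
      I ^ a₄ * (1 + I) ^ b₄ * (2 + I) ^ c₄ * (2 - I) ^ d₄ := by norm_num [Complex.ext_iff, pow_succ])
    (hm : (((b₂ : ℚ) - b₁) * ((c₄ : ℚ) - c₃) - ((c₂ : ℚ) - c₁) * ((b₄ : ℚ) - b₃)) -
        (((b₂ : ℚ) - b₁) * ((d₄ : ℚ) - d₃) - ((d₂ : ℚ) - d₁) * ((b₄ : ℚ) - b₃)) = m := by norm_num)
    (hn : 2 * (((c₂ : ℚ) - c₁) * ((d₄ : ℚ) - d₃) - ((d₂ : ℚ) - d₁) * ((c₄ : ℚ) - c₃)) = n := by norm_num) :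
    dehn u v (FreeAbelianGroup.of z) = m ∧ dehn v w (FreeAbelianGroup.of z) = n := by
  obtain ⟨uz, uzc⟩ := ext_of_mul_gsecMonomial u hz
  obtain ⟨vz, vzc⟩ := ext_of_mul_gsecMonomial v hz
  obtain ⟨wz, wzc⟩ := ext_of_mul_gsecMonomial w hz
  obtain ⟨uz', uzc'⟩ := ext_of_mul_gsecMonomial u hz'
  obtain ⟨vz', vzc'⟩ := ext_of_mul_gsecMonomial v hz'
  obtain ⟨wz', wzc'⟩ := ext_of_mul_gsecMonomial w hz'
  have hc : (1 : ℂ) - conj z = conj (1 - z) := by rw [map_sub, map_one]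
  simp only [dehn_of, asym, sym]
  rw [hc, uz, uzc, vz, vzc, wz, wzc, uz', uzc', vz', vzc', wz', wzc', hu₁, hu₂, hu₃, hv₁, hv₂, hv₃,
    hw₁, hw₂, hw₃]
  subst hm hn
  constructor <;> ring

end monomials

/-- **Stub (c5 cycle 4, worker): the Dehn invariant of the 15 class representatives, read by the valuation characters.** For characters
as in `stub_gsecChars`, `dehn u v [r_j] = F₁(r_j)` and `dehn v w [r_j] = 2F₂(r_j)` with the explicit integers below (factorisations
`r_j = i^a (1+i)^b (2+i)^c (2−i)^d`, `1 − r_j` likewise; `ext` is additive, kills `i`; `sym`/`asym`/`dehn_of`). Table (j: (a,b,c,d) of r_j;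
of 1−r_j): 0:(0,0,4,0);(0,7,0,1) 1:(0,0,−2,2);(2,6,−2,0) 2:(0,3,0,−1);(3,0,2,−1) 3:(0,2,1,0);(0,0,0,2) 4:(0,−2,0,0);(1,−2,1,0)
5:(0,−2,1,0);(2,−2,0,1) 6:(2,0,1,0);(0,1,0,1) 7:(3,0,0,0);(0,1,0,0) 8:(0,−1,0,1);(1,−1,1,0) 9:(2,1,0,0);(0,0,1,0) 10:(3,0,0,1);(3,3,0,0)
11:(3,−1,2,0);(2,−1,0,2) 12:(2,0,0,2);(1,5,0,0) 13:(2,0,1,−1);(2,4,0,−1) 14:(2,−4,0,3);(2,−4,3,0). Each row is `dehn_row` at the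
multiplicative form `r_j · M₁ = M₂`, `(1 − r_j) · M₃ = M₄` of these factorisations (negative exponents moved to the left).
[cite: Neumann1998, §2.1 end (pp. 393–394)] -/
theorem stub_gsecDehnRows :
    ∀ u v w : Additive ℂˣ →+ ℚ,
      ZagierDilogarithmConjectureNegative.ext u (1 + Complex.I) = 1 → ZagierDilogarithmConjectureNegative.ext u (2 + Complex.I) = 0 → ZagierDilogarithmConjectureNegative.ext u (2 - Complex.I) = 0 →
      ZagierDilogarithmConjectureNegative.ext v (1 + Complex.I) = 0 → ZagierDilogarithmConjectureNegative.ext v (2 + Complex.I) = 1 → ZagierDilogarithmConjectureNegative.ext v (2 - Complex.I) = 0 →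
      ZagierDilogarithmConjectureNegative.ext w (1 + Complex.I) = 0 → ZagierDilogarithmConjectureNegative.ext w (2 + Complex.I) = 0 → ZagierDilogarithmConjectureNegative.ext w (2 - Complex.I) = 1 →
      (dehn u v (FreeAbelianGroup.of ((-7 : ℂ) + (24 : ℂ) * Complex.I)) = (-28 : ℚ) ∧
        dehn u v (FreeAbelianGroup.of ((-7 / 25 : ℂ) + (-24 / 25 : ℂ) * Complex.I)) = (24 : ℚ) ∧
        dehn u v (FreeAbelianGroup.of ((-6 / 5 : ℂ) + (2 / 5 : ℂ) * Complex.I)) = (9 : ℚ) ∧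
        dehn u v (FreeAbelianGroup.of ((-2 : ℂ) + (4 : ℂ) * Complex.I)) = (-4 : ℚ) ∧
        dehn u v (FreeAbelianGroup.of ((-1 / 2 : ℂ) * Complex.I)) = (-2 : ℚ) ∧
        dehn u v (FreeAbelianGroup.of ((1 / 2 : ℂ) + (-1 : ℂ) * Complex.I)) = (4 : ℚ) ∧
        dehn u v (FreeAbelianGroup.of ((-2 : ℂ) + (-1 : ℂ) * Complex.I)) = (-1 : ℚ) ∧
        dehn u v (FreeAbelianGroup.of ((-1 : ℂ) * Complex.I)) = (0 : ℚ) ∧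
        dehn u v (FreeAbelianGroup.of ((1 / 2 : ℂ) + (-3 / 2 : ℂ) * Complex.I)) = (-2 : ℚ) ∧
        dehn u v (FreeAbelianGroup.of ((-1 : ℂ) + (-1 : ℂ) * Complex.I)) = (1 : ℚ) ∧
        dehn u v (FreeAbelianGroup.of ((-1 : ℂ) + (-2 : ℂ) * Complex.I)) = (3 : ℚ) ∧
        dehn u v (FreeAbelianGroup.of ((1 / 2 : ℂ) + (-7 / 2 : ℂ) * Complex.I)) = (4 : ℚ) ∧
        dehn u v (FreeAbelianGroup.of ((-3 : ℂ) + (4 : ℂ) * Complex.I)) = (10 : ℚ) ∧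
        dehn u v (FreeAbelianGroup.of ((-3 / 5 : ℂ) + (-4 / 5 : ℂ) * Complex.I)) = (-8 : ℚ) ∧
        dehn u v (FreeAbelianGroup.of ((1 / 2 : ℂ) + (-11 / 4 : ℂ) * Complex.I)) = (-24 : ℚ)) ∧
      (dehn v w (FreeAbelianGroup.of ((-7 : ℂ) + (24 : ℂ) * Complex.I)) = (8 : ℚ) ∧
        dehn v w (FreeAbelianGroup.of ((-7 / 25 : ℂ) + (-24 / 25 : ℂ) * Complex.I)) = (8 : ℚ) ∧
        dehn v w (FreeAbelianGroup.of ((-6 / 5 : ℂ) + (2 / 5 : ℂ) * Complex.I)) = (4 : ℚ) ∧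
        dehn v w (FreeAbelianGroup.of ((-2 : ℂ) + (4 : ℂ) * Complex.I)) = (4 : ℚ) ∧
        dehn v w (FreeAbelianGroup.of ((-1 / 2 : ℂ) * Complex.I)) = (0 : ℚ) ∧
        dehn v w (FreeAbelianGroup.of ((1 / 2 : ℂ) + (-1 : ℂ) * Complex.I)) = (2 : ℚ) ∧
        dehn v w (FreeAbelianGroup.of ((-2 : ℂ) + (-1 : ℂ) * Complex.I)) = (2 : ℚ) ∧
        dehn v w (FreeAbelianGroup.of ((-1 : ℂ) * Complex.I)) = (0 : ℚ) ∧
        dehn v w (FreeAbelianGroup.of ((1 / 2 : ℂ) + (-3 / 2 : ℂ) * Complex.I)) = (-2 : ℚ) ∧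
        dehn v w (FreeAbelianGroup.of ((-1 : ℂ) + (-1 : ℂ) * Complex.I)) = (0 : ℚ) ∧
        dehn v w (FreeAbelianGroup.of ((-1 : ℂ) + (-2 : ℂ) * Complex.I)) = (0 : ℚ) ∧
        dehn v w (FreeAbelianGroup.of ((1 / 2 : ℂ) + (-7 / 2 : ℂ) * Complex.I)) = (8 : ℚ) ∧
        dehn v w (FreeAbelianGroup.of ((-3 : ℂ) + (4 : ℂ) * Complex.I)) = (0 : ℚ) ∧
        dehn v w (FreeAbelianGroup.of ((-3 / 5 : ℂ) + (-4 / 5 : ℂ) * Complex.I)) = (-2 : ℚ) ∧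
        dehn v w (FreeAbelianGroup.of ((1 / 2 : ℂ) + (-11 / 4 : ℂ) * Complex.I)) = (-18 : ℚ)) := by
  intro u v w hu₁ hu₂ hu₃ hv₁ hv₂ hv₃ hw₁ hw₂ hw₃
  have R := @dehn_row u v w hu₁ hu₂ hu₃ hv₁ hv₂ hv₃ hw₁ hw₂ hw₃
  -- row j: `R r_j a₁ b₁ c₁ d₁ a₂ b₂ c₂ d₂ a₃ b₃ c₃ d₃ a₄ b₄ c₄ d₄ (dehn u v [r_j]) (dehn v w [r_j])` encodes
  -- `r_j · i^a₁ ρ^b₁ π^c₁ π̄^d₁ = i^a₂ ρ^b₂ π^c₂ π̄^d₂` and `(1 − r_j) · i^a₃ ρ^b₃ π^c₃ π̄^d₃ = i^a₄ ρ^b₄ π^c₄ π̄^d₄`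
  -- (`ρ = 1+i`, `π = 2+i`, `π̄ = 2−i`); the four side goals are discharged by the `norm_num` auto-params.
  -- row 0: `r = π⁴`, `1 − r = ρ⁷ π̄`
  obtain ⟨e0, f0⟩ := R ((-7 : ℂ) + (24 : ℂ) * Complex.I) 0 0 0 0 0 0 4 0 0 0 0 0 0 7 0 1 (-28) 8
  -- row 1: `r = π⁻² π̄²`, `1 − r = i² ρ⁶ π⁻²`
  obtain ⟨e1, f1⟩ := R ((-7 / 25 : ℂ) + (-24 / 25 : ℂ) * Complex.I) 0 0 2 0 0 0 0 2 0 0 2 0 2 6 0 0 24 8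
  -- row 2: `r = ρ³ π̄⁻¹`, `1 − r = i³ π² π̄⁻¹`
  obtain ⟨e2, f2⟩ := R ((-6 / 5 : ℂ) + (2 / 5 : ℂ) * Complex.I) 0 0 0 1 0 3 0 0 0 0 0 1 3 0 2 0 9 4
  -- row 3: `r = ρ² π`, `1 − r = π̄²`
  obtain ⟨e3, f3⟩ := R ((-2 : ℂ) + (4 : ℂ) * Complex.I) 0 0 0 0 0 2 1 0 0 0 0 0 0 0 0 2 (-4) 4
  -- row 4: `r = ρ⁻²`, `1 − r = i ρ⁻² π`
  obtain ⟨e4, f4⟩ := R ((-1 / 2 : ℂ) * Complex.I) 0 2 0 0 0 0 0 0 0 2 0 0 1 0 1 0 (-2) 0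
  -- row 5: `r = ρ⁻² π`, `1 − r = i² ρ⁻² π̄`
  obtain ⟨e5, f5⟩ := R ((1 / 2 : ℂ) + (-1 : ℂ) * Complex.I) 0 2 0 0 0 0 1 0 0 2 0 0 2 0 0 1 4 2
  -- row 6: `r = i² π`, `1 − r = ρ π̄`
  obtain ⟨e6, f6⟩ := R ((-2 : ℂ) + (-1 : ℂ) * Complex.I) 0 0 0 0 2 0 1 0 0 0 0 0 0 1 0 1 (-1) 2
  -- row 7: `r = i³`, `1 − r = ρ`
  obtain ⟨e7, f7⟩ := R ((-1 : ℂ) * Complex.I) 0 0 0 0 3 0 0 0 0 0 0 0 0 1 0 0 0 0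
  -- row 8: `r = ρ⁻¹ π̄`, `1 − r = i ρ⁻¹ π`
  obtain ⟨e8, f8⟩ := R ((1 / 2 : ℂ) + (-3 / 2 : ℂ) * Complex.I) 0 1 0 0 0 0 0 1 0 1 0 0 1 0 1 0 (-2) (-2)
  -- row 9: `r = i² ρ`, `1 − r = π`
  obtain ⟨e9, f9⟩ := R ((-1 : ℂ) + (-1 : ℂ) * Complex.I) 0 0 0 0 2 1 0 0 0 0 0 0 0 0 1 0 1 0
  -- row 10: `r = i³ π̄`, `1 − r = i³ ρ³`
  obtain ⟨e10, f10⟩ := R ((-1 : ℂ) + (-2 : ℂ) * Complex.I) 0 0 0 0 3 0 0 1 0 0 0 0 3 3 0 0 3 0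
  -- row 11: `r = i³ ρ⁻¹ π²`, `1 − r = i² ρ⁻¹ π̄²`
  obtain ⟨e11, f11⟩ := R ((1 / 2 : ℂ) + (-7 / 2 : ℂ) * Complex.I) 0 1 0 0 3 0 2 0 0 1 0 0 2 0 0 2 4 8
  -- row 12: `r = i² π̄²`, `1 − r = i ρ⁵`
  obtain ⟨e12, f12⟩ := R ((-3 : ℂ) + (4 : ℂ) * Complex.I) 0 0 0 0 2 0 0 2 0 0 0 0 1 5 0 0 10 0
  -- row 13: `r = i² π π̄⁻¹`, `1 − r = i² ρ⁴ π̄⁻¹`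
  obtain ⟨e13, f13⟩ := R ((-3 / 5 : ℂ) + (-4 / 5 : ℂ) * Complex.I) 0 0 0 1 2 0 1 0 0 0 0 1 2 4 0 0 (-8) (-2)
  -- row 14: `r = i² ρ⁻⁴ π̄³`, `1 − r = i² ρ⁻⁴ π³`
  obtain ⟨e14, f14⟩ := R ((1 / 2 : ℂ) + (-11 / 4 : ℂ) * Complex.I) 0 4 0 0 2 0 0 3 0 4 0 0 2 0 3 0 (-24) (-18)
  exact ⟨⟨e0, e1, e2, e3, e4, e5, e6, e7, e8, e9, e10, e11, e12, e13, e14⟩,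
    ⟨f0, f1, f2, f3, f4, f5, f6, f7, f8, f9, f10, f11, f12, f13, f14⟩⟩

end Summit.KontsevichZagierPeriods.HyperbolicBloch.ZagierDilogarithmCertificate

end
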